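import Literature.Algebra.Homology.TateCohomologyFiniteCyclic
import Literature.Algebra.Homology.CyclicExtensionUnitsCohomology
import HarnessLib

/-!
# `Ĥ⁰(Gal(L/K), Lˣ) = Kˣ / N_{L/K} Lˣ` for a finite Galois extension, and for `L/K` cyclic
# `Ĥ^{even}(Gal(L/K), Lˣ) ≅ Kˣ / N_{L/K} Lˣ`, `Ĥ^{odd}(Gal(L/K), Lˣ) = 0` (Serre, *Local Fields*
# VIII §1, VIII §4 Cor., X §1 Prop. 2, X §7 e)) — on Mathlib's `tateCohomology`

Topic `Algebra/Homology`; namespace `Literature.Algebra.Homology.CyclicExtension`.  Imports the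
tree's `TateCohomologyFiniteCyclic` (`Ĥⁿ` of a finite cyclic group by parity, all `n ∈ ℤ`) and
`CyclicExtensionUnitsCohomology` (the `Gal(L/K)`-module `Lˣ = Rep.ofAlgebraAutOnUnits K L`:
`(Lˣ)^{Gal} ≅ Kˣ`, `(Lˣ)^{Gal}/N(Lˣ) ≅ Kˣ/N_{L/K}Lˣ`, `H^{odd} = 0`); definitions with bodies (the
isomorphisms) and theorems; NO named fact, no `sorry`.  Lane `lit-hodgefound` (Track 2 foundations
library), seat p30 gen 16, row g16-#6 of `run/shared/lean/pub/lit-hodgefound/SKELETON.md`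
(re-creation of the lost gen-15 draft g15-#9).

Sources followed, VERBATIM.  J.-P. Serre, *Local Fields*, GTM 67 (1979) [held copy
`book:serre1979-local-fields`]: VIII §1 [chunk p0117] "`Ĥ⁰(G, A) = A^G/NA`"; VIII §4 Corollary
[p0121] "`Ĥ^q(G, A) = A^G/NA` for `q ≡ 0 mod 2`, `Ĥ^q(G, A) = _N A/DA` for `q ≡ 1 mod 2`" (`G`
cyclic); X §1 Prop. 2 (Hilbert's Theorem 90) "`H¹(G(L/K), L^*) = 0`"; X §7 e) [the field `ℝ`]:
"`B_ℝ = ℂ^{*G}/Nℂ^* = ℝ^*/ℝ^*_+ = ℤ/2ℤ`".  For the `Gal(L/K)`-module `A = Lˣ`: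
`A^G = Kˣ` (`L/K` Galois) and `NA = N_{L/K}(Lˣ)` (the norm element is the field norm), so
`Ĥ⁰(Gal(L/K), Lˣ) = Kˣ/N_{L/K}Lˣ` for every finite Galois `L/K`, and for `L/K` cyclic all even
Tate groups are `Kˣ/N_{L/K}Lˣ` while all odd ones are `H¹ = 0`; in particular
`Ĥ⁻¹(Gal(L/K), Lˣ) = 0` ("an element of norm `1` is of the form `σx/x`", the original Satz 90, is
the statement `_N A = DA`).

## What is formalised (`K L : Type`, fields, `L/K` finite Galois)

* **`tateCohomologyZeroUnitsIso K L : tateCohomology (Rep.ofAlgebraAutOnUnits K L) 0 ≅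
  ModuleCat.of ℤ (Additive Kˣ ⧸ range N_{L/K})`** (any finite Galois `L/K`; the tree's
  `tateCohomologyZeroIso` + `CyclicExtension.cokerNormBarEquiv`).
* `L/K` cyclic, `Gal(L/K) = ⟨g⟩`: **`tateCohomologyUnitsIsoEven`** (`Ĥⁿ ≅ Kˣ/N_{L/K}Lˣ`, every
  even `n ∈ ℤ`), **`isZero_tateCohomology_units_odd`** (`Ĥⁿ = 0`, every odd `n ∈ ℤ`),
  `isZero_tateCohomology_units_negOne` (Hilbert 90 in Tate degree `-1`).
* `ℂ/ℝ`: `natCard_tateCohomology_units_complex_real_even` (`|Ĥ^{even}(Gal(ℂ/ℝ), ℂˣ)| = 2`),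
  `isZero_tateCohomology_units_complex_real_odd`.

Not here: the identification of the period isomorphism with the cup product by the fundamental
class (local class field theory proper); `Ĥ⁻²(Gal, Lˣ)`-type statements beyond parity.

## References
* J.-P. Serre, *Local Fields*, GTM 67, Springer (1979), VIII §1, VIII §4 (Corollary to Prop. 6),
  X §1 Prop. 2, X §7 e). [Serre1979]
-/

noncomputable section

open CategoryTheory CategoryTheory.Limits Additive

namespace Literature.Algebra.Homology

namespace CyclicExtension

variable (K L : Type) [Field K] [Field L] [Algebra K L] [FiniteDimensional K L] [IsGalois K L]

/-! ## §1 Any finite Galois extension: `Ĥ⁰(Gal(L/K), Lˣ) = Kˣ / N_{L/K} Lˣ` -/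

set_option backward.isDefEq.respectTransparency false in
/-- **Serre VIII §1 for `A = Lˣ`: `Ĥ⁰(Gal(L/K), Lˣ) = (Lˣ)^{Gal}/N(Lˣ) ≅ Kˣ / N_{L/K} Lˣ`** for
every finite Galois extension `L/K` (additively written), on Mathlib's `tateCohomology`.
[cite: Serre1979, VIII §1; XIII §2 Cor. to Prop. 5 (proof)] -/
def tateCohomologyZeroUnitsIso :
    tateCohomology (Rep.ofAlgebraAutOnUnits K L) 0 ≅
      ModuleCat.of ℤ (Additive Kˣ ⧸ LinearMap.range (unitsNorm K L)) :=
  tateCohomologyZeroIso (Rep.ofAlgebraAutOnUnits K L) ≪≫ (cokerNormBarEquiv K L).toModuleIso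

/-- `|Ĥ⁰(Gal(L/K), Lˣ)| = [Kˣ : N_{L/K} Lˣ]`. [cite: Serre1979, VIII §1] -/
theorem natCard_tateCohomology_zero_units :
    Nat.card (tateCohomology (Rep.ofAlgebraAutOnUnits K L) 0) =
      Nat.card (Additive Kˣ ⧸ LinearMap.range (unitsNorm K L)) :=
  Nat.card_congr (tateCohomologyZeroUnitsIso K L).toLinearEquiv.toEquiv

/-! ## §2 `L/K` cyclic: `Ĥ^{even} ≅ Kˣ/N_{L/K}Lˣ`, `Ĥ^{odd} = 0` -/

variable [IsCyclic (L ≃ₐ[K] L)] (g : L ≃ₐ[K] L)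

attribute [local instance] IsCyclic.commGroup

set_option backward.isDefEq.respectTransparency false in
/-- **For `L/K` finite cyclic with `Gal(L/K) = ⟨g⟩` and every EVEN `n ∈ ℤ`:
`Ĥⁿ(Gal(L/K), Lˣ) ≅ Kˣ / N_{L/K} Lˣ`** (Serre VIII §4 Cor.: `Ĥ^q = A^G/NA` for `q` even).
[cite: Serre1979, VIII §4 Cor. to Prop. 6; XIII §2 Cor. to Prop. 5 (proof)] -/
def tateCohomologyUnitsIsoEven (hg : ∀ x, x ∈ Subgroup.zpowers g) (n : ℤ) (hn : Even n) :
    tateCohomology (Rep.ofAlgebraAutOnUnits K L) n ≅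
      ModuleCat.of ℤ (Additive Kˣ ⧸ LinearMap.range (unitsNorm K L)) := by
  classical
  exact FiniteCyclic.tateCohomologyIsoEven (Rep.ofAlgebraAutOnUnits K L) g hg n hn ≪≫
    (cokerNormBarEquiv K L).toModuleIso

/-- `|Ĥⁿ(Gal(L/K), Lˣ)| = [Kˣ : N_{L/K} Lˣ]` for `n` even, `L/K` cyclic.
[cite: Serre1979, VIII §4 Cor. to Prop. 6] -/
theorem natCard_tateCohomology_units_even (hg : ∀ x, x ∈ Subgroup.zpowers g) (n : ℤ)
    (hn : Even n) :
    Nat.card (tateCohomology (Rep.ofAlgebraAutOnUnits K L) n) =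
      Nat.card (Additive Kˣ ⧸ LinearMap.range (unitsNorm K L)) :=
  Nat.card_congr (tateCohomologyUnitsIsoEven K L g hg n hn).toLinearEquiv.toEquiv

omit [IsGalois K L] in
set_option backward.isDefEq.respectTransparency false in
/-- **For `L/K` finite cyclic and every ODD `n ∈ ℤ`: `Ĥⁿ(Gal(L/K), Lˣ) = 0`** — `Ĥⁿ ≅ _N A/DA =
ker N̄ ≅ H¹` (Serre VIII §4 Cor.) and `H¹(Gal(L/K), Lˣ) = 0` (Hilbert's Theorem 90, X §1 Prop. 2).
[cite: Serre1979, VIII §4 Cor. to Prop. 6; X §1 Prop. 2] -/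
theorem isZero_tateCohomology_units_odd (hg : ∀ x, x ∈ Subgroup.zpowers g) (n : ℤ) (hn : Odd n) :
    IsZero (tateCohomology (Rep.ofAlgebraAutOnUnits K L) n) := by
  classical
  have e₁ := FiniteCyclic.groupCohomologyIsoOdd (Rep.ofAlgebraAutOnUnits K L) g hg 1 odd_one
  have eₙ := FiniteCyclic.tateCohomologyIsoOdd (Rep.ofAlgebraAutOnUnits K L) g hg n hn
  haveI : Subsingleton (LinearMap.ker (normBar (Rep.ofAlgebraAutOnUnits K L).ρ)) := by
    refine ⟨fun a b => e₁.toLinearEquiv.symm.injective ?_⟩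
    exact Subsingleton.elim (α := groupCohomology.H1 (Rep.ofAlgebraAutOnUnits K L)) _ _
  exact (ModuleCat.isZero_of_subsingleton _).of_iso eₙ

omit [IsGalois K L] in
/-- **Hilbert 90 in Tate degree `-1`: `Ĥ⁻¹(Gal(L/K), Lˣ) = _N(Lˣ)/D(Lˣ) = 0`** for `L/K` finite
cyclic (an element of norm `1` is of the form `g x / x`).
[cite: Serre1979, X §1 Prop. 2; VIII §4 Cor. to Prop. 6] -/
theorem isZero_tateCohomology_units_negOne (hg : ∀ x, x ∈ Subgroup.zpowers g) :
    IsZero (tateCohomology (Rep.ofAlgebraAutOnUnits K L) (-1)) :=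
  isZero_tateCohomology_units_odd K L g hg (-1) (by decide)

/-! ## §3 Example `ℂ/ℝ`: `|Ĥ^{even}(Gal(ℂ/ℝ), ℂˣ)| = 2`, `Ĥ^{odd} = 0` -/

section Real

open Complex

set_option backward.isDefEq.respectTransparency false in
/-- **`Ĥⁿ(Gal(ℂ/ℝ), ℂˣ)` has exactly two elements for every even `n ∈ ℤ`** ("`B_ℝ = ℂ^{*G}/Nℂ^* =
ℝ^*/ℝ^*_+ = ℤ/2ℤ`" continued by the period). [cite: Serre1979, X §7 e); VIII §4 Cor. to Prop. 6] -/
theorem natCard_tateCohomology_units_complex_real_even (n : ℤ) (hn : Even n) :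
    Nat.card (tateCohomology (Rep.ofAlgebraAutOnUnits ℝ ℂ) n) = 2 := by
  rw [natCard_tateCohomology_units_even ℝ ℂ conjAe mem_zpowers_conjAe n hn]
  exact natCard_quotient_range_unitsNorm_complex_real

set_option backward.isDefEq.respectTransparency false in
/-- … and **`Ĥⁿ(Gal(ℂ/ℝ), ℂˣ) = 0` for every odd `n ∈ ℤ`.**
[cite: Serre1979, X §7 e); VIII §4 Cor. to Prop. 6] -/
theorem isZero_tateCohomology_units_complex_real_odd (n : ℤ) (hn : Odd n) :
    IsZero (tateCohomology (Rep.ofAlgebraAutOnUnits ℝ ℂ) n) :=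
  isZero_tateCohomology_units_odd ℝ ℂ conjAe mem_zpowers_conjAe n hn

end Real

end CyclicExtension

end Literature.Algebra.Homology
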